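/-
Copyright (c) 2026 the pub-hodgecm-mathlib formalisation cell (harness21).  Prover seat hodgecm-mathlib-K2Liu-p02 (g9), Track B «K2-LIT» ∕ hLiu418
#184♮, Road I v3, unit U5 «THE CLOSE», FACE-D₀ row `h2₂`: the (B1c′) TIE — ★ p863332's model letters `Tg`∕`hκ` DISCHARGED at the line Cayley mover
(LEAD F0P6-plan (g15) BATCH #181 (5) ∕ #183 (1) ∕ #206 (1); F0P2-p10 (g3) FILE 2 ★ p863784∕p863828∕p863869; K2Liu-p09 (g9) seam notes, 2026-09-05).  THEOREMS ONLY.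
-/
import Summits.HodgeConjecture.HodgeConjecture.Theorems.K2LiuLinePairKappaModelLetter          -- ★ p863896: `exists_Tg_pairRep_line_of_cayley`, `aInvMat_eq_one_of_aMat_eq_one` (+ ★ p863770, ★ p863642)
import Summits.HodgeConjecture.HodgeConjecture.Theorems.K2LiuLinePairCayleySiegelUnipotent     -- ★ p863869 (F0P2-p10 FILE 2c): `ratSp_lineCayleyMover_conj_toSp_mem_siegelParabolicPi`, `aMat_cMat_lineKappa_of_mem_unipDelta`
import Summits.HodgeConjecture.HodgeConjecture.Theorems.K2LiuFirstTermLineLiftRankRowModelConj  -- ★ p863332: `fourierCoeffDelta_thetaLift_eq_zero_of_finLineModel_conj`, `h2Row_thetaSide_of_finLineModel_conj`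
import HarnessLib

/-!
# K2_Liu road (hLiu418 = stmt-HodgeConjecture-24832), FACE-D₀ row `h2₂`, THE (B1c′) TIE: `Λ_S ≡ 0` ∕ row `h2₂` of the theta side AT THE LINE CAYLEY
# MOVER — ★ p863332's `Tg`, `hκ` REPLACED by two archimedean-vanishing letters on `X_{ι z}` and ONE eq-letter `hρf`

Cell `pub/hodgecm-mathlib` (D-0151), Track B, build stream 29; helper lane `--supports stmt-HodgeConjecture-24832 --as helper`, count-neutral.

INPUTS BY NAME (all ★): F0P2-p10 (g3)'s line Cayley mover `κ′ := reindex (e₁′ ⊕ e₁′) (D_{a′} κ_n D_{a′}⁻¹)` (`lineCayleyMover_mem_symplecticGroup`) with the membership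
letter `ratSp_lineCayleyMover_conj_toSp_mem_siegelParabolicPi` (`ratSp κ′ · ι(p ⊗ 1) · (ratSp κ′)⁻¹ ∈ P_𝕐(T₁)`, `p ∈ P_Δ(𝔸)`) and the readings
`aMat_cMat_lineKappa_of_mem_unipDelta` (`a = 1`, `c =` explicit) of `q_u := ratSp κ′ · ι(u ⊗ 1) · (ratSp κ′)⁻¹`, `u ∈ N_Δ(𝔸)`; this seat's ★ p863896
`exists_Tg_pairRep_line_of_cayley` (the `hκ` shape from readings; over ★ p863770 κ-model, ★ p863642 metaplectic rigidity, ★ p863400 finite slot).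
* §1 `cMat_lineKappa_map_archHom_eq_zero` — if the frame coordinate `X_u = (blk u)₁₂` has vanishing archimedean `re`∕`im` parts, the chirp parameter
  `c_{q_u}` has vanishing archimedean part (★ reading + `Matrix.map` algebra); `smul_cMat_lineKappa_map_archHom_eq_zero` (`S_u := −½ c_{q_u}`).
* §2 **`exists_Tg_pairRep_line_lineCayley`** — `∃ Tg, ∀ z Φ_∞ φ, Tg (ω(toDiagA (ι z), 1) (Tg⁻¹ (Φ_∞ ⊗ φ))) = Φ_∞ ⊗ ρf z φ` (the `hκ` binder of ★ p863332 :209–:217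
  VERBATIM) from: `ι : Z → N_Δ(𝔸)`, `hre`∕`him : ∀ z`, the archimedean `re`∕`im` parts of `X_{ι z}` vanish, and `hρf : ρf z φ = ψ_f(q_{(S z)_f}) · φ` with
  `S z := (−⅟2) • cMat q_{ι z}`.
* §3 **`fourierCoeffDelta_thetaLift_eq_zero_of_lineCayley`**, **`h2Row_thetaSide_of_lineCayley`** — ★ p863332's two heads with the binders `Tg`, `hκ` GONE
  (section variables :67–:125 of ★ p863332 VERBATIM; new letters `hre him hρf` only).  RESIDUE of FACE-D₀ `h2₂` (theta side) after this file = K2E3-p23 (g8)'s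
  S-letters (`σ hσ hσF π hπ ψ hψ ρf b hb a ha v hu hρm βloc hherm hdet χ hχ ι hχS` + `hre him hρf`), the linear readings `Bl`∕`cfS`, and `hρ μW fw νN hβ hβtop`.

No definition, no instance, no notation, no named-fact hypothesis, no `sorry`; axioms ⊆ {propext, Classical.choice, Quot.sound}.  HONEST LABEL: HC_CM is proved
only modulo the 7 printed citations (2 remaining named inputs: hLiu418 = stmt-HodgeConjecture-24832, h413 = stmt-HodgeConjecture-24833) until rung 0 closes; this file
moves no counter (`h2₂` is discharged only when the S-letters are ★ and tied).

References: [Weil1964] A. Weil, Acta Math. 111 (1964), Chap. I n° 13 p. 160, n° 34 p. 184, Chap. III n° 40–41 pp. 190–193; [Kudla1994] S. S. Kudla, Israel J.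
Math. 87 (1994), §3; [Rallis1984] S. Rallis, Compositio Math. 51 (1984) §4; [KudlaRallis1994] §3; [Liu2021] Y. Liu, Camb. J. Math. 9 (2021), App. B Prop. B.8 p. 104.
-/

set_option autoImplicit false
set_option linter.dupNamespace false
-- the line-pair carriers elaborate to very large types; elaborate sequentially (as in ★ `K2LiuFirstTermLineLiftRankRowModelConj`)
set_option Elab.async false

noncomputable section

open NumberField NumberField.mixedEmbedding MeasureTheory IsDedekindDomain
open scoped Matrix ComplexOrder ENNReal TensorProduct SchwartzMap Classical  -- `Classical`: as ★ p863332

namespace Summit.HodgeConjecture.HodgeConjecture.Cruxes.HLiu418.K2LiuFirstTermLineLiftRankRowCayley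

open Literature.NumberTheory.Automorphic Literature.NumberTheory.Automorphic.UnitaryGroup
open Literature.NumberTheory.Automorphic.UnitaryGroup.QuadraticCoordinates
open Literature.NumberTheory.Automorphic.IdeleClassGroup
open Literature.NumberTheory.Automorphic.Liu2021
open Literature.NumberTheory.Automorphic.Liu2021.Def411WeilCarriers
open Literature.NumberTheory.Automorphic.Liu2021.Def411WeilCarriersDoubling
open Literature.NumberTheory.GelbartRogawski1991 Literature.NumberTheory.GelbartRogawski1991.UnitaryDualPair
open Literature.NumberTheory.GelbartRogawski1991.GRConstruction
open Literature.NumberTheory.GaloisRepresentations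
open Literature.NumberTheory.Weil1964
open Literature.RepresentationTheory Literature.RepresentationTheory.Liu2021
open Literature.RepresentationTheory.HeisenbergGroup
open Literature.NumberTheory.K2Lit.DoubledLineTheta Literature.NumberTheory.K2Lit.SiegelDoubled
open Literature.MeasureTheory.Group
open Summit.HodgeConjecture.HodgeConjecture.Cruxes.HLiu418.K2LiuSiegelUnipotentFourierDefs
open Summit.HodgeConjecture.HodgeConjecture.Cruxes.HLiu418.K2LiuSiegelUnipotentCharacters
open Summit.HodgeConjecture.HodgeConjecture.Cruxes.HLiu418.K2LiuUnipotentCoveringWeight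
open Summit.HodgeConjecture.HodgeConjecture.Cruxes.HLiu418.K2LiuFirstTermLineLiftRankRow
open Summit.HodgeConjecture.HodgeConjecture.Cruxes.HLiu418.K2LiuFirstTermLineLiftRankRowModelConj
  (fourierCoeffDelta_thetaLift_eq_zero_of_finLineModel_conj h2Row_thetaSide_of_finLineModel_conj)
open Summit.HodgeConjecture.HodgeConjecture.Cruxes.HLiu418.K2LiuLinePairCayleySiegel (lineCayleyMover_mem_symplecticGroup)
open Summit.HodgeConjecture.HodgeConjecture.Cruxes.HLiu418.K2LiuLinePairCayleySiegelUnipotent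
  (ratSp_lineCayleyMover_conj_toSp_mem_siegelParabolicPi aMat_cMat_lineKappa_of_mem_unipDelta)
open Summit.HodgeConjecture.HodgeConjecture.Cruxes.HLiu418.K2LiuLinePairKappaModelLetter (exists_Tg_pairRep_line_of_cayley aInvMat_eq_one_of_aMat_eq_one)

/-! ## §1 The chirp parameter of a unipotent with archimedean-trivial coordinate has vanishing archimedean part -/

section Arch

variable (L : Type) [Field L] [NumberField L] [IsCMField L]
variable {N M n : ℕ} (e : Fin N × Fin M ≃ Fin n)
  (dV : Fin N → L) (hdV : ∀ i, IsCMField.complexConj L (dV i) = dV i)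
  (dW : Fin M → L) (hdW : ∀ i, IsCMField.complexConj L (dW i) = dW i)
  {n'' : ℕ} (e₁ : Fin (n + n) × Fin 1 ≃ Fin n'') (hdV0 : ∀ i, dV i ≠ 0) (hdW0 : ∀ i, dW i ≠ 0) (a' : (Fp L)ˣ)

set_option maxHeartbeats 1000000 in -- the statement carries the line datum's `toSp` term (default times out at `whnf`, measured; as ★ p863869's 800000)
/-- **`(c_{q_u})_∞ = 0` when `(X_u)_∞ = 0`**: if the archimedean parts of the quadratic coordinates `re X_u`, `im X_u` of the frame coordinate `X_u = (blk u)₁₂` of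
`u ∈ N_Δ(𝔸)` vanish, so does the archimedean part of the chirp parameter `c_{q_u}` of `q_u = ratSp κ′ · ι(u ⊗ 1) · (ratSp κ′)⁻¹` (★ F0P2-p10's reading: every block of
`c_{q_u}` is a product with a factor `re(−X_u − X_u)` or `im(−X_u − X_u)`). [cite: Weil1964, Chap. III n° 46 p. 202] [cite: Kudla1994, §3] -/
theorem cMat_lineKappa_map_archHom_eq_zero {u : HA L e dV hdV dW hdW} (hu : u ∈ unipDelta L e dV hdV dW hdW)
    (hre : (((blk L e dV hdV dW hdW u).toBlocks₁₂).map (re (quadraticAdeleEquiv (Fp L) L (IsCMField.complexConj L) (complexConj_imagUnit L) (imagUnit_ne_zero L)).toAddEquiv)).map (archHom (Fp L)) = 0)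
    (him : (((blk L e dV hdV dW hdW u).toBlocks₁₂).map (im (quadraticAdeleEquiv (Fp L) L (IsCMField.complexConj L) (complexConj_imagUnit L) (imagUnit_ne_zero L)).toAddEquiv)).map (archHom (Fp L)) = 0) :
    (SiegelParabolicPi.cMat (ratSp (Fp L) (adelicGram (Fp L) e₁ (realDiagonal L (dD L e dV hdV dW hdW) (dD_conj L e dV hdV dW hdW)) (TW (Fp L) a'))
          (isUnit_det_adelicGram (Fp L) e₁
            (isUnit_det_realDiagonal L (dD L e dV hdV dW hdW) (dD_conj L e dV hdV dW hdW) (dD_ne_zero L e dV hdV dW hdW hdV0 hdW0))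
            (isUnit_det_TW (Fp L) a')) (⟨_, lineCayleyMover_mem_symplecticGroup (Fp L) n ((Equiv.prodUnique (Fin (n + n)) (Fin 1)).symm.trans e₁) (Units.mul_inv a')⟩ :
            Matrix.symplecticGroup (Fin n'') (Fp L)) *
        toSp (Fp L) L (IsCMField.complexConj L) (n + n) 1 e₁ (Matrix.diagonal (dD L e dV hdV dW hdW)) (JW (Fp L) L a')
          (complexConj_imagUnit L) (imagUnit_ne_zero L) (imagUnit_mul_self L)
          (realDiagonal_isSymm L (dD L e dV hdV dW hdW) (dD_conj L e dV hdV dW hdW)) (isSymm_TW (Fp L) a')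
          (realDiagonal_map L (dD L e dV hdV dW hdW) (dD_conj L e dV hdV dW hdW)).symm (JW_eq (Fp L) L a')
          (UnitaryGroup.adelicInl (Fp L) L (IsCMField.complexConj L) (n + n) 1 (Matrix.diagonal (dD L e dV hdV dW hdW)) (JW (Fp L) L a')
            (toDiagA L e dV hdV dW hdW u)) *
        (ratSp (Fp L) (adelicGram (Fp L) e₁ (realDiagonal L (dD L e dV hdV dW hdW) (dD_conj L e dV hdV dW hdW)) (TW (Fp L) a'))
          (isUnit_det_adelicGram (Fp L) e₁
            (isUnit_det_realDiagonal L (dD L e dV hdV dW hdW) (dD_conj L e dV hdV dW hdW) (dD_ne_zero L e dV hdV dW hdW hdV0 hdW0))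
            (isUnit_det_TW (Fp L) a')) (⟨_, lineCayleyMover_mem_symplecticGroup (Fp L) n ((Equiv.prodUnique (Fin (n + n)) (Fin 1)).symm.trans e₁) (Units.mul_inv a')⟩ :
            Matrix.symplecticGroup (Fin n'') (Fp L)))⁻¹)).map (archHom (Fp L)) = 0 := by
  have hY : ∀ f : AdeleRing (𝓞 L) L →+ AdeleRing (𝓞 (Fp L)) (Fp L),
      (((blk L e dV hdV dW hdW u).toBlocks₁₂).map f).map (archHom (Fp L)) = 0 →
        ((-(blk L e dV hdV dW hdW u).toBlocks₁₂ - (blk L e dV hdV dW hdW u).toBlocks₁₂).map f).map (archHom (Fp L)) = 0 := by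
    intro f hf
    rw [Matrix.map_sub _ (map_sub f), Matrix.map_neg _ (map_neg f), Matrix.map_sub _ (map_sub (archHom (Fp L))),
      Matrix.map_neg _ (map_neg (archHom (Fp L))), hf, neg_zero, sub_zero]
  have hre' := hY _ hre
  have him' := hY _ him
  rw [(aMat_cMat_lineKappa_of_mem_unipDelta L e dV hdV hdV0 dW hdW hdW0 e₁ a' (isUnit_det_adelicGram (Fp L) e₁
            (isUnit_det_realDiagonal L (dD L e dV hdV dW hdW) (dD_conj L e dV hdV dW hdW) (dD_ne_zero L e dV hdV dW hdW hdV0 hdW0))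
            (isUnit_det_TW (Fp L) a'))
    (JW (Fp L) L a') (realDiagonal_isSymm L (dD L e dV hdV dW hdW) (dD_conj L e dV hdV dW hdW)) (isSymm_TW (Fp L) a')
    (realDiagonal_map L (dD L e dV hdV dW hdW) (dD_conj L e dV hdV dW hdW)).symm (JW_eq (Fp L) L a') hu).2]
  rw [Matrix.transpose_one, Matrix.one_mul]
  -- freeze the two coordinate blocks (`blk` is a `reindex`, which `Matrix.reindex_apply` would unfold)
  generalize (-(blk L e dV hdV dW hdW u).toBlocks₁₂ - (blk L e dV hdV dW hdW u).toBlocks₁₂).map (re (quadraticAdeleEquiv (Fp L) L (IsCMField.complexConj L) (complexConj_imagUnit L) (imagUnit_ne_zero L)).toAddEquiv) = A at hre' ⊢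
  generalize (-(blk L e dV hdV dW hdW u).toBlocks₁₂ - (blk L e dV hdV dW hdW u).toBlocks₁₂).map (im (quadraticAdeleEquiv (Fp L) L (IsCMField.complexConj L) (complexConj_imagUnit L) (imagUnit_ne_zero L)).toAddEquiv) = B at him' ⊢
  simp only [Matrix.reindex_apply, ← Matrix.submatrix_map, Matrix.map_smul' _ _ _ (map_mul (archHom (Fp L))), Matrix.map_mul,
    Matrix.fromBlocks_map, hre', him', Matrix.mul_zero, Matrix.zero_mul, smul_zero, Matrix.fromBlocks_zero, Matrix.submatrix_zero,
    Pi.zero_apply]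

set_option maxHeartbeats 1000000 in -- idem
/-- **`(S_u)_∞ = 0`** for `S_u := (−⅟2) • c_{q_u}`. [cite: Weil1964, Chap. I n° 34 p. 184] -/
theorem smul_cMat_lineKappa_map_archHom_eq_zero {u : HA L e dV hdV dW hdW} (hu : u ∈ unipDelta L e dV hdV dW hdW)
    (hre : (((blk L e dV hdV dW hdW u).toBlocks₁₂).map (re (quadraticAdeleEquiv (Fp L) L (IsCMField.complexConj L) (complexConj_imagUnit L) (imagUnit_ne_zero L)).toAddEquiv)).map (archHom (Fp L)) = 0)
    (him : (((blk L e dV hdV dW hdW u).toBlocks₁₂).map (im (quadraticAdeleEquiv (Fp L) L (IsCMField.complexConj L) (complexConj_imagUnit L) (imagUnit_ne_zero L)).toAddEquiv)).map (archHom (Fp L)) = 0) :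
    ((-⅟(2 : AdeleRing (𝓞 (Fp L)) (Fp L))) • SiegelParabolicPi.cMat (ratSp (Fp L) (adelicGram (Fp L) e₁ (realDiagonal L (dD L e dV hdV dW hdW) (dD_conj L e dV hdV dW hdW)) (TW (Fp L) a'))
          (isUnit_det_adelicGram (Fp L) e₁
            (isUnit_det_realDiagonal L (dD L e dV hdV dW hdW) (dD_conj L e dV hdV dW hdW) (dD_ne_zero L e dV hdV dW hdW hdV0 hdW0))
            (isUnit_det_TW (Fp L) a')) (⟨_, lineCayleyMover_mem_symplecticGroup (Fp L) n ((Equiv.prodUnique (Fin (n + n)) (Fin 1)).symm.trans e₁) (Units.mul_inv a')⟩ :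
            Matrix.symplecticGroup (Fin n'') (Fp L)) *
        toSp (Fp L) L (IsCMField.complexConj L) (n + n) 1 e₁ (Matrix.diagonal (dD L e dV hdV dW hdW)) (JW (Fp L) L a')
          (complexConj_imagUnit L) (imagUnit_ne_zero L) (imagUnit_mul_self L)
          (realDiagonal_isSymm L (dD L e dV hdV dW hdW) (dD_conj L e dV hdV dW hdW)) (isSymm_TW (Fp L) a')
          (realDiagonal_map L (dD L e dV hdV dW hdW) (dD_conj L e dV hdV dW hdW)).symm (JW_eq (Fp L) L a')
          (UnitaryGroup.adelicInl (Fp L) L (IsCMField.complexConj L) (n + n) 1 (Matrix.diagonal (dD L e dV hdV dW hdW)) (JW (Fp L) L a')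
            (toDiagA L e dV hdV dW hdW u)) *
        (ratSp (Fp L) (adelicGram (Fp L) e₁ (realDiagonal L (dD L e dV hdV dW hdW) (dD_conj L e dV hdV dW hdW)) (TW (Fp L) a'))
          (isUnit_det_adelicGram (Fp L) e₁
            (isUnit_det_realDiagonal L (dD L e dV hdV dW hdW) (dD_conj L e dV hdV dW hdW) (dD_ne_zero L e dV hdV dW hdW hdV0 hdW0))
            (isUnit_det_TW (Fp L) a')) (⟨_, lineCayleyMover_mem_symplecticGroup (Fp L) n ((Equiv.prodUnique (Fin (n + n)) (Fin 1)).symm.trans e₁) (Units.mul_inv a')⟩ :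
            Matrix.symplecticGroup (Fin n'') (Fp L)))⁻¹)).map (archHom (Fp L)) = 0 := by
  rw [Matrix.map_smul' _ _ _ (map_mul (archHom (Fp L))), cMat_lineKappa_map_archHom_eq_zero L e dV hdV dW hdW e₁ hdV0 hdW0 a' hu hre him, smul_zero]

end Arch

/-! ## §2 The `hκ` shape AT THE LINE CAYLEY MOVER: every Cayley-specific letter ★, three S-letters left -/

section Shape

variable (L : Type) [Field L] [NumberField L] [IsCMField L]
variable {N M n : ℕ} (e : Fin N × Fin M ≃ Fin n)
  (dV : Fin N → L) (hdV : ∀ i, IsCMField.complexConj L (dV i) = dV i)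
  (dW : Fin M → L) (hdW : ∀ i, IsCMField.complexConj L (dW i) = dW i)
  {n'' : ℕ} (e₁ : Fin (n + n) × Fin 1 ≃ Fin n'') (hdV0 : ∀ i, dV i ≠ 0) (hdW0 : ∀ i, dW i ≠ 0)
  (lam : IdeleClassGroup L →ₜ* Circle) (hlam : IsConjugateSymplectic L lam) (a' : (Fp L)ˣ)

set_option maxHeartbeats 1000000 in -- idem
/-- **THE `hκ` LETTER OF ★ p863332 AT THE LINE CAYLEY MOVER.**  For an index map `ι : Z → N_Δ(𝔸)` whose frame coordinates have vanishing archimedean quadratic coordinates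
(`hre`, `him`) and a finite-slot representation `ρf` with `hρf : ρf z φ = ψ_f(q_{(S z)_f}) · φ`, `S z := (−⅟2) • c_{q_{ι z}}`:
`∃ Tg, ∀ z Φ_∞ φ, Tg (ω(toDiagA (ι z), 1) (Tg⁻¹ (Φ_∞ ⊗ φ))) = Φ_∞ ⊗ ρf z φ` — `Tg = ω(r_F κ′)` with F0P2-p10's ★ mover `κ′`, membership ★ and readings ★.
[cite: Weil1964, Chap. I n° 13 p. 160, n° 34 p. 184; Chap. III n° 40–41 pp. 190–193] [cite: Kudla1994, §3] [cite: Liu2021, App. B Prop. B.8 p. 104] -/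
theorem exists_Tg_pairRep_line_lineCayley {Z : Type*} [Group Z] (ι : Z → ↥(unipDelta L e dV hdV dW hdW))
    (hre : ∀ z, (((blk L e dV hdV dW hdW ((ι z : ↥(unipDelta L e dV hdV dW hdW)) : HA L e dV hdV dW hdW)).toBlocks₁₂).map (re (quadraticAdeleEquiv (Fp L) L (IsCMField.complexConj L) (complexConj_imagUnit L) (imagUnit_ne_zero L)).toAddEquiv)).map (archHom (Fp L)) = 0)
    (him : ∀ z, (((blk L e dV hdV dW hdW ((ι z : ↥(unipDelta L e dV hdV dW hdW)) : HA L e dV hdV dW hdW)).toBlocks₁₂).map (im (quadraticAdeleEquiv (Fp L) L (IsCMField.complexConj L) (complexConj_imagUnit L) (imagUnit_ne_zero L)).toAddEquiv)).map (archHom (Fp L)) = 0)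
    (ρf : Representation ℂ Z (FinSB (Fp L) (Fin n'')))
    (hρf : ∀ (z : Z) (φ : FinSB (Fp L) (Fin n'')), ρf z φ =
      finMulLM (finSdChar ((((-⅟(2 : AdeleRing (𝓞 (Fp L)) (Fp L))) • SiegelParabolicPi.cMat (ratSp (Fp L) (adelicGram (Fp L) e₁ (realDiagonal L (dD L e dV hdV dW hdW) (dD_conj L e dV hdV dW hdW)) (TW (Fp L) a'))
          (isUnit_det_adelicGram (Fp L) e₁
            (isUnit_det_realDiagonal L (dD L e dV hdV dW hdW) (dD_conj L e dV hdV dW hdW) (dD_ne_zero L e dV hdV dW hdW hdV0 hdW0))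
            (isUnit_det_TW (Fp L) a')) (⟨_, lineCayleyMover_mem_symplecticGroup (Fp L) n ((Equiv.prodUnique (Fin (n + n)) (Fin 1)).symm.trans e₁) (Units.mul_inv a')⟩ :
            Matrix.symplecticGroup (Fin n'') (Fp L)) *
        toSp (Fp L) L (IsCMField.complexConj L) (n + n) 1 e₁ (Matrix.diagonal (dD L e dV hdV dW hdW)) (JW (Fp L) L a')
          (complexConj_imagUnit L) (imagUnit_ne_zero L) (imagUnit_mul_self L)
          (realDiagonal_isSymm L (dD L e dV hdV dW hdW) (dD_conj L e dV hdV dW hdW)) (isSymm_TW (Fp L) a')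
          (realDiagonal_map L (dD L e dV hdV dW hdW) (dD_conj L e dV hdV dW hdW)).symm (JW_eq (Fp L) L a')
          (UnitaryGroup.adelicInl (Fp L) L (IsCMField.complexConj L) (n + n) 1 (Matrix.diagonal (dD L e dV hdV dW hdW)) (JW (Fp L) L a')
            (toDiagA L e dV hdV dW hdW ((ι z : ↥(unipDelta L e dV hdV dW hdW)) : HA L e dV hdV dW hdW))) *
        (ratSp (Fp L) (adelicGram (Fp L) e₁ (realDiagonal L (dD L e dV hdV dW hdW) (dD_conj L e dV hdV dW hdW)) (TW (Fp L) a'))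
          (isUnit_det_adelicGram (Fp L) e₁
            (isUnit_det_realDiagonal L (dD L e dV hdV dW hdW) (dD_conj L e dV hdV dW hdW) (dD_ne_zero L e dV hdV dW hdW hdV0 hdW0))
            (isUnit_det_TW (Fp L) a')) (⟨_, lineCayleyMover_mem_symplecticGroup (Fp L) n ((Equiv.prodUnique (Fin (n + n)) (Fin 1)).symm.trans e₁) (Units.mul_inv a')⟩ :
            Matrix.symplecticGroup (Fin n'') (Fp L)))⁻¹))).map
        (RingHom.snd (InfiniteAdeleRing (Fp L)) (FiniteAdeleRing (𝓞 (Fp L)) (Fp L))))) (isLocallyConstant_finSdChar _) φ) :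
    ∃ Tg : ↥(piSchwartzBruhat (Fp L) (Fin n'')) ≃ₗ[ℂ] ↥(piSchwartzBruhat (Fp L) (Fin n'')),
      ∀ (z : Z) (Φinf : 𝓢((Fin n'' → mixedSpace (Fp L)), ℂ)) (φ : FinSB (Fp L) (Fin n'')),
        Tg (pairRep (Fp L) L (IsCMField.complexConj L) (n + n) 1 e₁ (Matrix.diagonal (dD L e dV hdV dW hdW)) (JW (Fp L) L a')
            (chiSplittingLine L e₁ (dD L e dV hdV dW hdW) (dD_conj L e dV hdV dW hdW) (dD_ne_zero L e dV hdV dW hdW hdV0 hdW0)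
              (toHeckeCharacter L lam) (isUnitary_toHeckeCharacter L lam)
              ((isOscillatorChar_toHeckeCharacter_iff lam).mpr hlam) (TW (Fp L) a')
              (isUnit_det_TW (Fp L) a') (JW (Fp L) L a') (JW_eq (Fp L) L a'))
            (toDiagA L e dV hdV dW hdW ((ι z : unipDelta L e dV hdV dW hdW) : HA L e dV hdV dW hdW), 1)
            (Tg.symm (piSchwartzBruhatEquiv (Fp L) (Fin n'') (Φinf ⊗ₜ[ℂ] φ)))) =
          piSchwartzBruhatEquiv (Fp L) (Fin n'') (Φinf ⊗ₜ[ℂ] ρf z φ) :=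
  exists_Tg_pairRep_line_of_cayley L e dV hdV dW hdW e₁ hdV0 hdW0 lam hlam a' (⟨_, lineCayleyMover_mem_symplecticGroup (Fp L) n ((Equiv.prodUnique (Fin (n + n)) (Fin 1)).symm.trans e₁) (Units.mul_inv a')⟩ :
            Matrix.symplecticGroup (Fin n'') (Fp L))
    (fun p => ratSp_lineCayleyMover_conj_toSp_mem_siegelParabolicPi L e dV hdV hdV0 dW hdW hdW0 e₁ a' (isUnit_det_adelicGram (Fp L) e₁
            (isUnit_det_realDiagonal L (dD L e dV hdV dW hdW) (dD_conj L e dV hdV dW hdW) (dD_ne_zero L e dV hdV dW hdW hdV0 hdW0))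
            (isUnit_det_TW (Fp L) a'))
      (JW (Fp L) L a') (realDiagonal_isSymm L (dD L e dV hdV dW hdW) (dD_conj L e dV hdV dW hdW)) (isSymm_TW (Fp L) a')
      (realDiagonal_map L (dD L e dV hdV dW hdW) (dD_conj L e dV hdV dW hdW)).symm (JW_eq (Fp L) L a') p.2)
    ι _
    (fun z => aInvMat_eq_one_of_aMat_eq_one
      (ratSp_lineCayleyMover_conj_toSp_mem_siegelParabolicPi L e dV hdV hdV0 dW hdW hdW0 e₁ a' (isUnit_det_adelicGram (Fp L) e₁
            (isUnit_det_realDiagonal L (dD L e dV hdV dW hdW) (dD_conj L e dV hdV dW hdW) (dD_ne_zero L e dV hdV dW hdW hdV0 hdW0))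
            (isUnit_det_TW (Fp L) a'))
        (JW (Fp L) L a') (realDiagonal_isSymm L (dD L e dV hdV dW hdW) (dD_conj L e dV hdV dW hdW)) (isSymm_TW (Fp L) a')
        (realDiagonal_map L (dD L e dV hdV dW hdW) (dD_conj L e dV hdV dW hdW)).symm (JW_eq (Fp L) L a')
        (unipDelta_le_siegelDelta L e dV hdV dW hdW (ι z).2))
      (aMat_cMat_lineKappa_of_mem_unipDelta L e dV hdV hdV0 dW hdW hdW0 e₁ a' (isUnit_det_adelicGram (Fp L) e₁
            (isUnit_det_realDiagonal L (dD L e dV hdV dW hdW) (dD_conj L e dV hdV dW hdW) (dD_ne_zero L e dV hdV dW hdW hdV0 hdW0))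
            (isUnit_det_TW (Fp L) a'))
        (JW (Fp L) L a') (realDiagonal_isSymm L (dD L e dV hdV dW hdW) (dD_conj L e dV hdV dW hdW)) (isSymm_TW (Fp L) a')
        (realDiagonal_map L (dD L e dV hdV dW hdW) (dD_conj L e dV hdV dW hdW)).symm (JW_eq (Fp L) L a') (ι z).2).1)
    (fun _ => rfl) (fun z => smul_cMat_lineKappa_map_archHom_eq_zero L e dV hdV dW hdW e₁ hdV0 hdW0 a' (ι z).2 (hre z) (him z)) ρf hρf

end Shape

/-! ## §3 ★ p863332's heads with `Tg`, `hκ` DISCHARGED (section variables :67–:125 of ★ p863332 verbatim) -/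

section Tie


variable (L : Type) [Field L] [NumberField L] [IsCMField L]
variable {N n : ℕ} (e : Fin N × Fin 1 ≃ Fin n)
  (dV : Fin N → L) (hdV : ∀ i, IsCMField.complexConj L (dV i) = dV i)
  (dW : Fin 1 → L) (hdW : ∀ i, IsCMField.complexConj L (dW i) = dW i)
  {n'' : ℕ} (e₁ : Fin (n + n) × Fin 1 ≃ Fin n'')
  (hdV0 : ∀ i, dV i ≠ 0) (hdW0 : ∀ i, dW i ≠ 0)
  (lam : IdeleClassGroup L →ₜ* Circle) (hlam : IsConjugateSymplectic L lam) (a' : (Fp L)ˣ)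
  (hρ : HasThetaMajorants fun
      (p : ↥(UnitaryGroup.adelic (Fp L) L (IsCMField.complexConj L) (n + n) (Matrix.diagonal (dD L e dV hdV dW hdW))) ×
        ↥(UnitaryGroup.adelic (Fp L) L (IsCMField.complexConj L) 1 (JW (Fp L) L a')))
      (Φ : piSchwartzBruhat (Fp L) (Fin n'')) =>
        pairRep (Fp L) L (IsCMField.complexConj L) (n + n) 1 e₁ (Matrix.diagonal (dD L e dV hdV dW hdW)) (JW (Fp L) L a')
          (chiSplittingLine L e₁ (dD L e dV hdV dW hdW) (dD_conj L e dV hdV dW hdW) (dD_ne_zero L e dV hdV dW hdW hdV0 hdW0)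
            (toHeckeCharacter L lam) (isUnitary_toHeckeCharacter L lam)
            ((isOscillatorChar_toHeckeCharacter_iff lam).mpr hlam) (TW (Fp L) a')
            (isUnit_det_TW (Fp L) a') (JW (Fp L) L a') (JW_eq (Fp L) L a'))
          p Φ)
  [MeasurableSpace (↥(UnitaryGroup.adelic (Fp L) L (IsCMField.complexConj L) 1 (JW (Fp L) L a')) ⧸
    (UnitaryGroup.toAdelic (Fp L) L (IsCMField.complexConj L) 1 (JW (Fp L) L a')).range)]
  [BorelSpace (↥(UnitaryGroup.adelic (Fp L) L (IsCMField.complexConj L) 1 (JW (Fp L) L a')) ⧸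
    (UnitaryGroup.toAdelic (Fp L) L (IsCMField.complexConj L) 1 (JW (Fp L) L a')).range)]
  (μW : Measure (↥(UnitaryGroup.adelic (Fp L) L (IsCMField.complexConj L) 1 (JW (Fp L) L a')) ⧸
    (UnitaryGroup.toAdelic (Fp L) L (IsCMField.complexConj L) 1 (JW (Fp L) L a')).range)) [IsFiniteMeasure μW]
  (fw : C(↥(UnitaryGroup.adelic (Fp L) L (IsCMField.complexConj L) 1 (JW (Fp L) L a')) ⧸
    (UnitaryGroup.toAdelic (Fp L) L (IsCMField.complexConj L) 1 (JW (Fp L) L a')).range, ℂ))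
  [MeasurableSpace (unipDelta L e dV hdV dW hdW)] [BorelSpace (unipDelta L e dV hdV dW hdW)]
  (νN : Measure (unipDelta L e dV hdV dW hdW)) [νN.IsMulLeftInvariant]
  {βw : unipDelta L e dV hdV dW hdW → ℝ≥0∞} (hβ : IsCoveringWeight (unipDeltaRat L e dV hdV dW hdW) βw) (hβtop : ∫⁻ u, βw u ∂νN ≠ ∞)
  (S : Matrix (Fin n) (Fin n) L)

/-! ## The letters: linear readings of the lift and of the coefficient, and the σ-explicit line model on `𝒮(𝔸_f^{n″})` -/

variable
  -- (i) ★ (t): the lift as a linear map of `Φ`, and ★ (c): the coefficient as a linear map on a class `P ∋ Bl Φ`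
  (Bl : ↥(piSchwartzBruhat (Fp L) (Fin n'')) →ₗ[ℂ] (HA L e dV hdV dW hdW → ℂ))
  (hBl : ∀ (Φ : piSchwartzBruhat (Fp L) (Fin n'')) (h : HA L e dV hdV dW hdW),
    Bl Φ h = doubledLineThetaLift L e dV hdV dW hdW e₁ hdV0 hdW0 lam hlam a' hρ μW Φ fw h)
  (P : Submodule ℂ (HA L e dV hdV dW hdW → ℂ)) (hPB : ∀ Φ, Bl Φ ∈ P) (cfS : ↥P →ₗ[ℂ] (HA L e dV hdV dW hdW → ℂ))
  (hcf : ∀ (y : ↥P) (h : HA L e dV hdV dW hdW), cfS y h = fourierCoeffDelta L e dV hdV dW hdW νN βw S (y : HA L e dV hdV dW hdW → ℂ) h)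
  -- (ii) the σ-explicit line model at one finite place, on the finite-adelic Schwartz–Bruhat space (★ U2a §1′ binders verbatim)
  {R : Type*} [CommRing R] {F : Type*} [Field F] [Algebra F R]
  (σ : R →+* R) (hσ : ∀ x, σ (σ x) = x) (hσF : ∀ c : F, σ (algebraMap F R c) = algebraMap F R c)
  (π : Matrix (Fin 2) (Fin 2) R →ₗ[F] Matrix (Fin 2) (Fin 2) R →ₗ[F] F)
  (hπ : ∀ H : Matrix (Fin 2) (Fin 2) R, (H.map σ)ᵀ = H → H ≠ 0 → ∃ s : Matrix (Fin 2) (Fin 2) R, (s.map σ)ᵀ = s ∧ π s H ≠ 0)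
  (ψ : AddChar F Circle) (hψ : ∃ t : F, ((ψ t : Circle) : ℂ) ≠ 1)
  {Z : Type*} [Group Z] (ρf : Representation ℂ Z (FinSB (Fp L) (Fin n'')))
  (b : Z → Matrix (Fin 2) (Fin 2) R) (hb : ∀ s : Matrix (Fin 2) (Fin 2) R, (s.map σ)ᵀ = s → ∃ z, b z = s)
  (a : R) (ha : σ a = a) (v : (Fin n'' → FiniteAdeleRing (𝓞 (Fp L)) (Fp L)) → Fin 2 → R)
  (hu : ∀ z, IsLocallyConstant fun x => ((ψ (π (b z) (a • Matrix.vecMulVec (⇑σ ∘ v x) (v x))) : Circle) : ℂ))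
  (hρm : ∀ (z : Z) (φ : FinSB (Fp L) (Fin n'')),
    ((ρf z φ : FinSB (Fp L) (Fin n'')) : (Fin n'' → FiniteAdeleRing (𝓞 (Fp L)) (Fp L)) → ℂ) =
      (fun x => ((ψ (π (b z) (a • Matrix.vecMulVec (⇑σ ∘ v x) (v x))) : Circle) : ℂ)) * φ)
  (βloc : Matrix (Fin 2) (Fin 2) R) (hherm : (βloc.map σ)ᵀ = βloc) (hdet : βloc.det ≠ 0)
  (χ : Z →* ℂˣ) (hχ : ∀ z, ((χ z : ℂˣ) : ℂ) = ((ψ (π (b z) βloc) : Circle) : ℂ))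
  -- (iii) the embedding `ι : Z → N_Δ(𝔸)` and the character match `χ = ψ_S ∘ ι` (the Weil∕model letter itself is `hκ` in the heads below)
  (ι : Z → unipDelta L e dV hdV dW hdW)
  (hχS : ∀ z : Z, ((χ z : ℂˣ) : ℂ) = (unipDeltaChar L e dV hdV dW hdW S (((ι z : unipDelta L e dV hdV dW hdW)) : HA L e dV hdV dW hdW) : ℂ))

include hBl hPB hcf hβ hβtop hσ hσF hπ hψ hb ha hu hρm hherm hdet hχ hχS


set_option maxHeartbeats 1000000 in -- idem
/-- **`Λ_S ≡ 0` AT THE LINE CAYLEY MOVER**: ★ `fourierCoeffDelta_thetaLift_eq_zero_of_finLineModel_conj` with its model letters `Tg`, `hκ` discharged by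
`exists_Tg_pairRep_line_lineCayley` — left: the archimedean-vanishing letters `hre him` of `X_{ι z}` and the eq-letter `hρf` (`S z := (−⅟2) • c_{q_{ι z}}`).
[cite: Rallis1984, §4] [cite: KudlaRallis1994, §3] [cite: Weil1964, Chap. I n° 13, Chap. III n° 37–38] -/
theorem fourierCoeffDelta_thetaLift_eq_zero_of_lineCayley
    (hre : ∀ z, (((blk L e dV hdV dW hdW ((ι z : ↥(unipDelta L e dV hdV dW hdW)) : HA L e dV hdV dW hdW)).toBlocks₁₂).map (re (quadraticAdeleEquiv (Fp L) L (IsCMField.complexConj L) (complexConj_imagUnit L) (imagUnit_ne_zero L)).toAddEquiv)).map (archHom (Fp L)) = 0)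
    (him : ∀ z, (((blk L e dV hdV dW hdW ((ι z : ↥(unipDelta L e dV hdV dW hdW)) : HA L e dV hdV dW hdW)).toBlocks₁₂).map (im (quadraticAdeleEquiv (Fp L) L (IsCMField.complexConj L) (complexConj_imagUnit L) (imagUnit_ne_zero L)).toAddEquiv)).map (archHom (Fp L)) = 0)
    (hρf : ∀ (z : Z) (φ : FinSB (Fp L) (Fin n'')), ρf z φ =
      finMulLM (finSdChar ((((-⅟(2 : AdeleRing (𝓞 (Fp L)) (Fp L))) • SiegelParabolicPi.cMat (ratSp (Fp L) (adelicGram (Fp L) e₁ (realDiagonal L (dD L e dV hdV dW hdW) (dD_conj L e dV hdV dW hdW)) (TW (Fp L) a'))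
          (isUnit_det_adelicGram (Fp L) e₁
            (isUnit_det_realDiagonal L (dD L e dV hdV dW hdW) (dD_conj L e dV hdV dW hdW) (dD_ne_zero L e dV hdV dW hdW hdV0 hdW0))
            (isUnit_det_TW (Fp L) a')) (⟨_, lineCayleyMover_mem_symplecticGroup (Fp L) n ((Equiv.prodUnique (Fin (n + n)) (Fin 1)).symm.trans e₁) (Units.mul_inv a')⟩ :
            Matrix.symplecticGroup (Fin n'') (Fp L)) *
        toSp (Fp L) L (IsCMField.complexConj L) (n + n) 1 e₁ (Matrix.diagonal (dD L e dV hdV dW hdW)) (JW (Fp L) L a')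
          (complexConj_imagUnit L) (imagUnit_ne_zero L) (imagUnit_mul_self L)
          (realDiagonal_isSymm L (dD L e dV hdV dW hdW) (dD_conj L e dV hdV dW hdW)) (isSymm_TW (Fp L) a')
          (realDiagonal_map L (dD L e dV hdV dW hdW) (dD_conj L e dV hdV dW hdW)).symm (JW_eq (Fp L) L a')
          (UnitaryGroup.adelicInl (Fp L) L (IsCMField.complexConj L) (n + n) 1 (Matrix.diagonal (dD L e dV hdV dW hdW)) (JW (Fp L) L a')
            (toDiagA L e dV hdV dW hdW ((ι z : ↥(unipDelta L e dV hdV dW hdW)) : HA L e dV hdV dW hdW))) *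
        (ratSp (Fp L) (adelicGram (Fp L) e₁ (realDiagonal L (dD L e dV hdV dW hdW) (dD_conj L e dV hdV dW hdW)) (TW (Fp L) a'))
          (isUnit_det_adelicGram (Fp L) e₁
            (isUnit_det_realDiagonal L (dD L e dV hdV dW hdW) (dD_conj L e dV hdV dW hdW) (dD_ne_zero L e dV hdV dW hdW hdV0 hdW0))
            (isUnit_det_TW (Fp L) a')) (⟨_, lineCayleyMover_mem_symplecticGroup (Fp L) n ((Equiv.prodUnique (Fin (n + n)) (Fin 1)).symm.trans e₁) (Units.mul_inv a')⟩ :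
            Matrix.symplecticGroup (Fin n'') (Fp L)))⁻¹))).map
        (RingHom.snd (InfiniteAdeleRing (Fp L)) (FiniteAdeleRing (𝓞 (Fp L)) (Fp L))))) (isLocallyConstant_finSdChar _) φ)
    (Φ : piSchwartzBruhat (Fp L) (Fin n'')) :
    fourierCoeffDelta L e dV hdV dW hdW νN βw S (doubledLineThetaLift L e dV hdV dW hdW e₁ hdV0 hdW0 lam hlam a' hρ μW Φ fw) 1 = 0 := by
  obtain ⟨Tg, hκ⟩ := exists_Tg_pairRep_line_lineCayley L e dV hdV dW hdW e₁ hdV0 hdW0 lam hlam a' ι hre him ρf hρf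
  exact fourierCoeffDelta_thetaLift_eq_zero_of_finLineModel_conj L e dV hdV dW hdW e₁ hdV0 hdW0 lam hlam a' hρ μW fw νN hβ hβtop S Bl hBl P hPB cfS hcf
    σ hσ hσF π hπ ψ hψ ρf b hb a ha v hu hρm βloc hherm hdet χ hχ ι hχS Tg hκ Φ

set_option maxHeartbeats 1000000 in -- idem
/-- **ROW `h2₂` OF FACE-D′ FOR THE THETA SIDE AT THE LINE CAYLEY MOVER**: ★ `h2Row_thetaSide_of_finLineModel_conj` with `Tg`, `hκ` discharged.
[cite: Rallis1984, §4] [cite: KudlaRallis1994, §3] [cite: Liu2021, App. B Prop. B.8 p. 104] -/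
theorem h2Row_thetaSide_of_lineCayley
    (hre : ∀ z, (((blk L e dV hdV dW hdW ((ι z : ↥(unipDelta L e dV hdV dW hdW)) : HA L e dV hdV dW hdW)).toBlocks₁₂).map (re (quadraticAdeleEquiv (Fp L) L (IsCMField.complexConj L) (complexConj_imagUnit L) (imagUnit_ne_zero L)).toAddEquiv)).map (archHom (Fp L)) = 0)
    (him : ∀ z, (((blk L e dV hdV dW hdW ((ι z : ↥(unipDelta L e dV hdV dW hdW)) : HA L e dV hdV dW hdW)).toBlocks₁₂).map (im (quadraticAdeleEquiv (Fp L) L (IsCMField.complexConj L) (complexConj_imagUnit L) (imagUnit_ne_zero L)).toAddEquiv)).map (archHom (Fp L)) = 0)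
    (hρf : ∀ (z : Z) (φ : FinSB (Fp L) (Fin n'')), ρf z φ =
      finMulLM (finSdChar ((((-⅟(2 : AdeleRing (𝓞 (Fp L)) (Fp L))) • SiegelParabolicPi.cMat (ratSp (Fp L) (adelicGram (Fp L) e₁ (realDiagonal L (dD L e dV hdV dW hdW) (dD_conj L e dV hdV dW hdW)) (TW (Fp L) a'))
          (isUnit_det_adelicGram (Fp L) e₁
            (isUnit_det_realDiagonal L (dD L e dV hdV dW hdW) (dD_conj L e dV hdV dW hdW) (dD_ne_zero L e dV hdV dW hdW hdV0 hdW0))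
            (isUnit_det_TW (Fp L) a')) (⟨_, lineCayleyMover_mem_symplecticGroup (Fp L) n ((Equiv.prodUnique (Fin (n + n)) (Fin 1)).symm.trans e₁) (Units.mul_inv a')⟩ :
            Matrix.symplecticGroup (Fin n'') (Fp L)) *
        toSp (Fp L) L (IsCMField.complexConj L) (n + n) 1 e₁ (Matrix.diagonal (dD L e dV hdV dW hdW)) (JW (Fp L) L a')
          (complexConj_imagUnit L) (imagUnit_ne_zero L) (imagUnit_mul_self L)
          (realDiagonal_isSymm L (dD L e dV hdV dW hdW) (dD_conj L e dV hdV dW hdW)) (isSymm_TW (Fp L) a')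
          (realDiagonal_map L (dD L e dV hdV dW hdW) (dD_conj L e dV hdV dW hdW)).symm (JW_eq (Fp L) L a')
          (UnitaryGroup.adelicInl (Fp L) L (IsCMField.complexConj L) (n + n) 1 (Matrix.diagonal (dD L e dV hdV dW hdW)) (JW (Fp L) L a')
            (toDiagA L e dV hdV dW hdW ((ι z : ↥(unipDelta L e dV hdV dW hdW)) : HA L e dV hdV dW hdW))) *
        (ratSp (Fp L) (adelicGram (Fp L) e₁ (realDiagonal L (dD L e dV hdV dW hdW) (dD_conj L e dV hdV dW hdW)) (TW (Fp L) a'))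
          (isUnit_det_adelicGram (Fp L) e₁
            (isUnit_det_realDiagonal L (dD L e dV hdV dW hdW) (dD_conj L e dV hdV dW hdW) (dD_ne_zero L e dV hdV dW hdW hdV0 hdW0))
            (isUnit_det_TW (Fp L) a')) (⟨_, lineCayleyMover_mem_symplecticGroup (Fp L) n ((Equiv.prodUnique (Fin (n + n)) (Fin 1)).symm.trans e₁) (Units.mul_inv a')⟩ :
            Matrix.symplecticGroup (Fin n'') (Fp L)))⁻¹))).map
        (RingHom.snd (InfiniteAdeleRing (Fp L)) (FiniteAdeleRing (𝓞 (Fp L)) (Fp L))))) (isLocallyConstant_finSdChar _) φ)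
    {D : Type*} [AddCommGroup D] [Module ℂ D] (𝓣 : D →ₗ[ℂ] piSchwartzBruhat (Fp L) (Fin n''))
    (T₂ : D →ₗ[ℂ] (HA L e dV hdV dW hdW → ℂ))
    (hT₂B : ∀ (x : D) (h : HA L e dV hdV dW hdW),
      T₂ x h = doubledLineThetaLift L e dV hdV dW hdW e₁ hdV0 hdW0 lam hlam a' hρ μW (𝓣 x) fw h)
    (hP₂ : ∀ x, T₂ x ∈ P) :
    cfS ∘ₗ LinearMap.codRestrict P T₂ hP₂ = 0 := by
  obtain ⟨Tg, hκ⟩ := exists_Tg_pairRep_line_lineCayley L e dV hdV dW hdW e₁ hdV0 hdW0 lam hlam a' ι hre him ρf hρf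
  exact h2Row_thetaSide_of_finLineModel_conj L e dV hdV dW hdW e₁ hdV0 hdW0 lam hlam a' hρ μW fw νN hβ hβtop S Bl hBl P hPB cfS hcf
    σ hσ hσF π hπ ψ hψ ρf b hb a ha v hu hρm βloc hherm hdet χ hχ ι hχS Tg hκ 𝓣 T₂ hT₂B hP₂

end Tie

end Summit.HodgeConjecture.HodgeConjecture.Cruxes.HLiu418.K2LiuFirstTermLineLiftRankRowCayley

end
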